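import Summits.QuantumFields.YangMills.Theorems.ColdStartUniversalityLatticeLangevinRegularFlowDecode
import HarnessLib

/-!
# Route `ColdStartUniversality` (rung input (M), crux K_A1 stmt-QuantumFields-24809): the REGULAR solution flow of the
# SU(2) lattice Langevin dynamics — progressively measurable in (time, start, ω), with a measurable continuity certificate

Helper file (seat `ym-line-csu-p1`, g4), probabilistic half of the construction (deterministic half:
`…LatticeLangevinRegularFlowDecode`).  `exists_regularFlow`: on every probability space with a flat Brownian motion there
are a solution family `U : SU(2)^E → (ℝ≥0 → Ω → SU(2)^E)` of the Shen–Zhu–Zhu system from every start (raw natural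
filtration) and a MEASURABLE set `G ⊆ SU(2)^E × Ω` with

* `(r, x, ω) ↦ U x r ω` on `[0, i] × SU(2)^E × Ω` measurable for `𝓑 ⊗ 𝓑 ⊗ 𝓕_i`, every `i` (progressive, jointly in
  the start — what adaptedness of a solution restarted at a random `𝓕_s`-measurable point needs);
* every path `r ↦ U x r ω` with `(x, ω) ∈ G` continuous, and `(x, ·) ∈ G` almost surely for every start (a continuity
  certificate — what Fubini/freezing over a random start needs; raw filtrations admit no all-paths-continuous adapted
  version).

Construction: nets `u ∘ ι n` and strong solutions from `…MeasurableFlow`/`…WellPosed`; `U x r ω = lim_n Ũ x (sampleLeft n r) ω`,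
`Ũ x d ω = lim_N U^{u (ι N x)}_d(ω)`; identification with the strong solution from `x` by `ae_tendsto_solutions`; the
certificate is «`Ũ x · ω` is entrywise locally uniformly continuous on the dyadics».  This is the input of the splicing
proof of the flow property (hypothesis of `chapmanKolmogorov_of_cocycle`).  No definition, no sorry.  RECORD-rung R3
plumbing; nothing here bears on the mass gap.
-/

set_option autoImplicit false

noncomputable section

namespace Summit.QuantumFields.YangMills.Theorems.ColdStartUniversality

open MeasureTheory ProbabilityTheory Filter Topology
open scoped NNReal ENNReal BigOperators
open Literature Literature.Probability.Process Literature.MathematicalPhysics.QuantumFieldTheory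
open Literature.MathematicalPhysics.QuantumLattice (fundamentalRep fundamentalLatticeRep continuous_fundamentalRep
  fundamentalRep_injective)

/-! ## The regular flow -/

section Flow

/-- Measurability of the decoded path at one time and one start (any σ-algebra on `Ω` making the net values at times
`≤ r` measurable; apply with `𝓕_r` for adaptedness). [folklore] -/
theorem measurable_decode_at {Ω : Type*} [MeasurableSpace Ω] {L : ℕ} [NeZero L]
    (V : ℕ → ℝ≥0 → Ω → GaugeConfig 3 L (Matrix.specialUnitaryGroup (Fin 2) ℂ))
    (ι : ℕ → GaugeConfig 3 L (Matrix.specialUnitaryGroup (Fin 2) ℂ) → ℕ) (hι : ∀ n, Measurable (ι n)) (r : ℝ≥0)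
    (hV : ∀ (k : ℕ) (d : ℝ≥0), d ≤ r → Measurable (V k d)) (x : GaugeConfig 3 L (Matrix.specialUnitaryGroup (Fin 2) ℂ)) :
    Measurable fun ω => limUnder atTop (fun n => limUnder atTop (fun N => V (ι N x) (sampleLeft n r) ω)) := by
  have h := measurable_decode V ι hι r hV
  have h2 : Measurable fun ω : Ω => ((⟨r, Set.mem_Iic.2 le_rfl⟩ : Set.Iic r), (x, ω)) :=
    measurable_const.prodMk (measurable_const.prodMk measurable_id)
  have h3 := h.comp h2
  have heq : (fun ω => limUnder atTop (fun n => limUnder atTop (fun N => V (ι N x) (sampleLeft n r) ω))) =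
      (fun q : Set.Iic r × (GaugeConfig 3 L (Matrix.specialUnitaryGroup (Fin 2) ℂ) × Ω) =>
        limUnder atTop (fun n => limUnder atTop (fun N => V (ι N q.2.1) (min (sampleLeft n q.1) r) q.2.2))) ∘
      (fun ω : Ω => ((⟨r, Set.mem_Iic.2 le_rfl⟩ : Set.Iic r), (x, ω))) := by
    funext ω
    simp only [Function.comp_apply, min_eq_left (sampleLeft_le' _ r)]
  rw [heq]
  exact h3

/-- **The regular solution flow of the SU(2) lattice Langevin dynamics.**  On every probability space with a flat
Brownian motion there are a solution family `U` from every start and a measurable set `G ⊆ SU(2)^E × Ω` such that: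
`U x` solves the SZZ system from `x` (raw natural filtration); `(r, x, ω) ↦ U x r ω` on `[0,i] × SU(2)^E × Ω` is
measurable for `𝓑 ⊗ 𝓑 ⊗ 𝓕_i` (progressive, jointly in the start); every path `r ↦ U x r ω` with `(x, ω) ∈ G` is
continuous; and `(x, ·) ∈ G` almost surely for every `x`. [cite: Kunita1984, Ch. II §2 Thm 2.2 (LNM 1097, p. 188)] -/
theorem exists_regularFlow (L : ℕ) [NeZero L] (β : ℝ) {Ω : Type} [MeasurableSpace Ω] {P : Measure Ω}
    [IsProbabilityMeasure P] {W : ℝ≥0 → Ω → (Edge 3 L × NoiseIdx 2 → ℝ)} (hW : IsFlatBrownian W P) :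
    ∃ (U : GaugeConfig 3 L (Matrix.specialUnitaryGroup (Fin 2) ℂ) → ℝ≥0 → Ω →
        GaugeConfig 3 L (Matrix.specialUnitaryGroup (Fin 2) ℂ))
      (G : Set (GaugeConfig 3 L (Matrix.specialUnitaryGroup (Fin 2) ℂ) × Ω)),
      (∀ x, (∀ ω, U x 0 ω = x) ∧
        (latticeLangevinDynamics (fundamentalLatticeRep 2) β).IsSolution (fundamentalRep (Fin 2))
          hW.natFiltration P W (U x)) ∧
      (∀ i : ℝ≥0, Measurable[@Prod.instMeasurableSpace (Set.Iic i)
          (GaugeConfig 3 L (Matrix.specialUnitaryGroup (Fin 2) ℂ) × Ω) inferInstance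
          (@Prod.instMeasurableSpace (GaugeConfig 3 L (Matrix.specialUnitaryGroup (Fin 2) ℂ)) Ω inferInstance
            (hW.natFiltration i))]
        (fun q : Set.Iic i × (GaugeConfig 3 L (Matrix.specialUnitaryGroup (Fin 2) ℂ) × Ω) => U q.2.1 q.1 q.2.2)) ∧
      MeasurableSet G ∧ (∀ q ∈ G, Continuous fun r => U q.1 r q.2) ∧ (∀ x, ∀ᵐ ω ∂P, (x, ω) ∈ G) := by
  classical
  haveI := secondCountableTopology_su2
  haveI := borelSpace_config L
  haveI := polishSpace_config L
  haveI : Nonempty (GaugeConfig 3 L (Matrix.specialUnitaryGroup (Fin 2) ℂ)) := ⟨fun _ => 1⟩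
  obtain ⟨u, ι, hι, hD⟩ := exists_measurable_nets L
  choose Ux hUx0 hUx using fun x : GaugeConfig 3 L (Matrix.specialUnitaryGroup (Fin 2) ℂ) =>
    solution_from_start hW β x
  have hmUx : ∀ x d, Measurable (Ux x d) := fun x d => ((hUx x).adapted d).mono (hW.natFiltration.le d) le_rfl
  -- the entry embedding and the inner limits
  have hEm : Measurable fun x : GaugeConfig 3 L (Matrix.specialUnitaryGroup (Fin 2) ℂ) =>
      fun e (i j : Fin 2) => (x e : Matrix (Fin 2) (Fin 2) ℂ) i j := continuous_entries.measurable
  have hinner : ∀ d : ℝ≥0, Measurable fun q : GaugeConfig 3 L (Matrix.specialUnitaryGroup (Fin 2) ℂ) × Ω =>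
      limUnder atTop (fun N => Ux (u (ι N q.1)) d q.2) := by
    intro d
    have hf : ∀ N, Measurable fun q : GaugeConfig 3 L (Matrix.specialUnitaryGroup (Fin 2) ℂ) × Ω =>
        Ux (u (ι N q.1)) d q.2 := fun N => by
      have h1 : Measurable fun p : Ω × ℕ => Ux (u p.2) d p.1 :=
        measurable_from_prod_countable_left fun k => hmUx (u k) d
      have h2 := h1.comp (measurable_snd.prodMk ((hι N).comp measurable_fst))
      exact h2
    exact (MeasureTheory.StronglyMeasurable.limUnder (l := atTop) fun N => (hf N).stronglyMeasurable).measurable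
  -- almost sure identification with the strong solutions
  have hae : ∀ x, ∀ᵐ ω ∂P, (∀ d, limUnder atTop (fun N => Ux (u (ι N x)) d ω) = Ux x d ω) ∧
      Continuous fun t => Ux x t ω := by
    intro x
    have h1 := ae_tendsto_solutions hW β (x := x) (xs := fun n => u (ι n x)) (fun n => (hD n x).le) (hUx0 x) (hUx x)
      (V := fun n => Ux (u (ι n x))) (fun n ω => hUx0 _ ω) (fun n => hUx _)
    filter_upwards [h1, (hUx x).continuous] with ω hω hc
    exact ⟨fun d => (hω d).limUnder_eq, hc⟩
  refine ⟨fun x r ω => limUnder atTop (fun n => limUnder atTop (fun N => Ux (u (ι N x)) (sampleLeft n r) ω)),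
    {q | ∀ m j : ℕ, ∃ k : ℕ, ∀ a b : ℕ × ℕ,
      (((a.2 : ℝ≥0) / 2 ^ a.1) ≤ m ∧ ((b.2 : ℝ≥0) / 2 ^ b.1) ≤ m ∧
        dist ((a.2 : ℝ≥0) / 2 ^ a.1) ((b.2 : ℝ≥0) / 2 ^ b.1) ≤ ((k : ℝ) + 1)⁻¹) →
      dist (fun e (i j : Fin 2) => (limUnder atTop (fun N => Ux (u (ι N q.1)) ((a.2 : ℝ≥0) / 2 ^ a.1) q.2) e :
          Matrix (Fin 2) (Fin 2) ℂ) i j)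
        (fun e (i j : Fin 2) => (limUnder atTop (fun N => Ux (u (ι N q.1)) ((b.2 : ℝ≥0) / 2 ^ b.1) q.2) e :
          Matrix (Fin 2) (Fin 2) ℂ) i j) ≤ ((j : ℝ) + 1)⁻¹},
    fun x => ⟨fun ω => ?_, ?_⟩, fun i => ?_, ?_, fun q hq => ?_, fun x => ?_⟩
  · -- start
    have h0 : ∀ n, sampleLeft n (0 : ℝ≥0) = 0 := fun n => by simp [sampleLeft]
    have hin : limUnder atTop (fun N => Ux (u (ι N x)) 0 ω) = x := by
      have hfun : (fun N => Ux (u (ι N x)) 0 ω) = fun N => u (ι N x) := funext fun N => hUx0 _ ω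
      rw [hfun]
      exact (tendsto_of_hsDist_tendsto_zero (squeeze_zero (fun n => hsDist_nonneg _ _) (fun n => (hD n x).le)
        (tendsto_pow_atTop_nhds_zero_of_lt_one (by norm_num) (by norm_num)))).limUnder_eq
    simp only [h0, hin]
    exact tendsto_const_nhds.limUnder_eq
  · -- solution: adapted and indistinguishable from `Ux x`
    refine isSolution_of_indist _ _ W (hUx x) (fun r => ?_) ?_
    · exact @measurable_decode_at Ω (hW.natFiltration r) L _ (fun k => Ux (u k)) ι hι r
        (fun k d hd => ((hUx (u k)).adapted d).mono (hW.natFiltration.mono hd) le_rfl) x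
    · filter_upwards [hae x] with ω hω
      intro r
      have hin : (fun n => limUnder atTop (fun N => Ux (u (ι N x)) (sampleLeft n r) ω)) =
          fun n => Ux x (sampleLeft n r) ω := funext fun n => hω.1 _
      rw [hin]
      exact ((hω.2.tendsto r).comp (tendsto_sampleLeft r)).limUnder_eq
  · -- progressive measurability, jointly in the start
    have h := @measurable_decode Ω (hW.natFiltration i) L _ (fun k => Ux (u k)) ι hι i
      (fun k d hd => ((hUx (u k)).adapted d).mono (hW.natFiltration.mono hd) le_rfl)
    have heq : (fun q : Set.Iic i × (GaugeConfig 3 L (Matrix.specialUnitaryGroup (Fin 2) ℂ) × Ω) =>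
        limUnder atTop (fun n => limUnder atTop (fun N => Ux (u (ι N q.2.1)) (sampleLeft n q.1) q.2.2))) =
        fun q => limUnder atTop (fun n => limUnder atTop
          (fun N => Ux (u (ι N q.2.1)) (min (sampleLeft n q.1) i) q.2.2)) := by
      funext q
      simp only [min_eq_left ((sampleLeft_le' _ (q.1 : ℝ≥0)).trans (Set.mem_Iic.1 q.1.2))]
    rw [heq]
    exact h
  · -- measurability of the certificate
    simp only [Set.setOf_forall, Set.setOf_exists]
    refine MeasurableSet.iInter fun m => MeasurableSet.iInter fun j => MeasurableSet.iUnion fun k =>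
      MeasurableSet.iInter fun a => MeasurableSet.iInter fun b => ?_
    have hdm : Measurable fun q : GaugeConfig 3 L (Matrix.specialUnitaryGroup (Fin 2) ℂ) × Ω =>
        dist (fun e (i j : Fin 2) => (limUnder atTop (fun N => Ux (u (ι N q.1)) ((a.2 : ℝ≥0) / 2 ^ a.1) q.2) e :
            Matrix (Fin 2) (Fin 2) ℂ) i j)
          (fun e (i j : Fin 2) => (limUnder atTop (fun N => Ux (u (ι N q.1)) ((b.2 : ℝ≥0) / 2 ^ b.1) q.2) e :
            Matrix (Fin 2) (Fin 2) ℂ) i j) := by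
      have h := (hEm.comp (hinner ((a.2 : ℝ≥0) / 2 ^ a.1))).dist (hEm.comp (hinner ((b.2 : ℝ≥0) / 2 ^ b.1)))
      exact h
    exact MeasurableSet.iInter fun _ => measurableSet_le hdm measurable_const
  · -- continuity on the certificate
    exact (continuous_decode (g := fun d => limUnder atTop (fun N => Ux (u (ι N q.1)) d q.2))
      (fun m j => (hq m j).imp fun k hk a b h1 h2 h3 => hk a b ⟨h1, h2, h3⟩)).2
  · -- the certificate holds almost surely for every start
    filter_upwards [hae x] with ω hω
    intro m j
    have hc : Continuous fun t : ℝ≥0 => fun e (i j : Fin 2) => (Ux x t ω e : Matrix (Fin 2) (Fin 2) ℂ) i j :=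
      continuous_entries.comp hω.2
    have huc := (isCompact_Icc (a := (0 : ℝ≥0)) (b := (m : ℝ≥0))).uniformContinuousOn_of_continuous hc.continuousOn
    rw [Metric.uniformContinuousOn_iff] at huc
    obtain ⟨δ, hδ, hδ'⟩ := huc (((j : ℝ) + 1)⁻¹) (by positivity)
    obtain ⟨k, hk⟩ := exists_nat_one_div_lt hδ
    refine ⟨k, fun a b hab => ?_⟩
    obtain ⟨ha, hb, hd⟩ := hab
    rw [hω.1, hω.1]
    have hlt : dist ((a.2 : ℝ≥0) / 2 ^ a.1) ((b.2 : ℝ≥0) / 2 ^ b.1) < δ := by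
      rw [one_div] at hk
      exact lt_of_le_of_lt hd hk
    exact (hδ' _ ⟨bot_le, ha⟩ _ ⟨bot_le, hb⟩ hlt).le

end Flow

end Summit.QuantumFields.YangMills.Theorems.ColdStartUniversality

end
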